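import Summits.KontsevichZagierPeriods.KontsevichZagierPeriods.Theorems.RootDecompRelativeModAbsoluteCylLogSplitP05

/-! # `RootDecompRelativeModAbsoluteCylLogSplitP06` — part 6/25 of the mechanical ≤330-line split of `CylLogSplit.lean`
(split by the decomp-kz census seat for landing; mathematics unchanged; part 6 continues part 5). -/

noncomputable section
open Set MeasureTheory Filter Topology
open scoped BigOperators
open Literature.NumberTheory.Transcendental Literature.ModelTheory.ExponentialFields

namespace Summit.KontsevichZagierPeriods.RootDecompRelativeModAbsolute.Rung30571

namespace RegularisedLogLayer

namespace CylLog
variable {b : ℕ}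

/-- Gluing two honest bands `[a, 1]` and `[1, c]` with the same kernel into one honest band `[a, c]`
(rule 1a backwards). -/
theorem exists_gluedRep {b m : ℕ} {G : Set (Fin b → ℝ)} {d a c : (Fin b → ℝ) → ℝ}
    (hG : IsSemialgebraic ℚ G) (hd : IsSemialgebraicFunOn ℚ G d) (ha : IsSemialgebraicFunOn ℚ G a)
    (hc : IsSemialgebraicFunOn ℚ G c) (ha0 : ∀ x ∈ G, 0 < a x) (ha1 : ∀ x ∈ G, a x ≤ 1)
    (hc1 : ∀ x ∈ G, 1 ≤ c x) (X Y : KZ.IntegralRep (b + 1))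
    (hXd : X.domain = KZlog.band G a (fun _ => 1))
    (hXi : EqOn X.integrand
      (fun z => d (Fin.init z) * ((z (Fin.last b) - 1) ^ m / z (Fin.last b))) X.domain)
    (hYd : Y.domain = KZlog.band G (fun _ => 1) c)
    (hYi : EqOn Y.integrand
      (fun z => d (Fin.init z) * ((z (Fin.last b) - 1) ^ m / z (Fin.last b))) Y.domain) :
    ∃ M : KZ.IntegralRep (b + 1), M.domain = KZlog.band G a c ∧
      EqOn M.integrand (fun z => d (Fin.init z) * ((z (Fin.last b) - 1) ^ m / z (Fin.last b)))
        M.domain ∧ KZ.of M - KZ.of X - KZ.of Y ∈ KZ.relations := by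
  have hone : IsSemialgebraicFunOn ℚ G (fun _ => (1 : ℝ)) := by
    simpa using isSemialgebraicFunOn_ratCast hG 1
  have hbac : IsSemialgebraic ℚ (KZlog.band G a c) := KZlog.isSemialgebraic_band ha hc
  have hunion : KZlog.band G a c = X.domain ∪ Y.domain := by
    rw [hXd, hYd]
    ext z
    simp only [KZlog.band, mem_setOf_eq, mem_union]
    constructor
    · rintro ⟨hx, h1, h2⟩
      rcases le_total (z (Fin.last b)) 1 with h | h
      · exact Or.inl ⟨hx, h1, h⟩
      · exact Or.inr ⟨hx, h, h2⟩
    · rintro (⟨hx, h1, h2⟩ | ⟨hx, h1, h2⟩)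
      · exact ⟨hx, h1, h2.trans (hc1 _ hx)⟩
      · exact ⟨hx, (ha1 _ hx).trans h1, h2⟩
  have hsa : IsSemialgebraicFunOn ℚ (KZlog.band G a c)
      (fun z => d (Fin.init z) * ((z (Fin.last b) - 1) ^ m / z (Fin.last b))) :=
    (isSemialgebraicFunOn_scaledKernel m hbac (fun z hz => hz.1) hd hone
      (fun z hz => ((ha0 _ hz.1).trans_le hz.2.1).ne')).congr fun z _ => by simp
  have hint : IntegrableOn
      (fun z : Fin (b + 1) → ℝ => d (Fin.init z) * ((z (Fin.last b) - 1) ^ m / z (Fin.last b)))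
      (KZlog.band G a c) := by
    rw [hunion]
    exact (X.integrableOn.congr_fun hXi (KZ.IntegralRep.measurableSet_domain_holds X)).union
      (Y.integrableOn.congr_fun hYi (KZ.IntegralRep.measurableSet_domain_holds Y))
  let M : KZ.IntegralRep (b + 1) :=
    { domain := KZlog.band G a c
      integrand := fun z => d (Fin.init z) * ((z (Fin.last b) - 1) ^ m / z (Fin.last b))
      isSemialgebraic_domain := hbac
      isSemialgebraicFunOn_integrand := hsa
      integrableOn := hint }
  refine ⟨M, rfl, fun _ _ => rfl, ?_⟩
  refine KZ.domainAddRel_subset_relations ⟨b + 1, M, X, Y, hunion, ?_, fun z hz => (hXi hz).symm,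
    fun z hz => (hYi hz).symm, rfl⟩
  refine measure_mono_null (fun z hz => ?_) (KZ.volume_graph_eq_zero hone)
  rw [hXd, hYd] at hz
  exact ⟨hz.1.1, le_antisymm hz.1.2.2 hz.2.2.1⟩

/-- **`RegTorusProductMixed₂` — `u ≥ 1 ≥ uw > 0` (`0 < w ≤ 1`), PROVED.**  Reversed bands
`R = [{uw≤t≤1}, dk]`, `R₂ = [{w≤s≤1}, dk]`; `R₁ = [{1≤t≤u}, dk]`:  `−[R] − [R₁] + [R₂] − [B] ∈ relations`. -/
theorem regTorusProductMixed₂ {b m : ℕ} {G : Set (Fin b → ℝ)} {d u w : (Fin b → ℝ) → ℝ}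
    (hGo : IsOpen G) (hG : IsSemialgebraic ℚ G) (hd : IsSemialgebraicFunOn ℚ G d)
    (hu : IsSemialgebraicFunOn ℚ G u) (hw : IsSemialgebraicFunOn ℚ G w)
    (hud : DifferentiableOn ℝ u G) (hu1 : ∀ x ∈ G, 1 ≤ u x) (hw0 : ∀ x ∈ G, 0 < w x)
    (hw1 : ∀ x ∈ G, w x ≤ 1) (huw : ∀ x ∈ G, u x * w x ≤ 1)
    (R R₁ R₂ : KZ.IntegralRep (b + 1)) (B : KZ.IntegralRep b)
    (hRd : R.domain = KZlog.band G (fun x => u x * w x) (fun _ => 1))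
    (hRi : EqOn R.integrand
      (fun z => d (Fin.init z) * ((z (Fin.last b) - 1) ^ m / z (Fin.last b))) R.domain)
    (hR₁d : R₁.domain = KZlog.band G (fun _ => 1) u)
    (hR₁i : EqOn R₁.integrand
      (fun z => d (Fin.init z) * ((z (Fin.last b) - 1) ^ m / z (Fin.last b))) R₁.domain)
    (hR₂d : R₂.domain = KZlog.band G w (fun _ => 1))
    (hR₂i : EqOn R₂.integrand
      (fun z => d (Fin.init z) * ((z (Fin.last b) - 1) ^ m / z (Fin.last b))) R₂.domain)
    (hBd : B.domain = G) (hBi : EqOn B.integrand (fun x => d x * rho m (u x) (w x)) B.domain) :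
    -KZ.of R - KZ.of R₁ + KZ.of R₂ - KZ.of B ∈ KZ.relations := by
  have huwf : IsSemialgebraicFunOn ℚ G (fun x => u x * w x) := IsSemialgebraicFunOn.mul_holds hu hw
  have hc1 : IsSemialgebraicFunOn ℚ G (fun _ => (1 : ℝ)) := by
    simpa using isSemialgebraicFunOn_ratCast hG 1
  have hu0 : ∀ x ∈ G, 0 < u x := fun x hx => one_pos.trans_le (hu1 x hx)
  have huw0 : ∀ x ∈ G, 0 < u x * w x := fun x hx => mul_pos (hu0 x hx) (hw0 x hx)
  -- 1. glue `R` and `R₁` into `M = [uw, u]`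
  obtain ⟨M, hMd, hMi, hM⟩ := exists_gluedRep (m := m) hG hd huwf hu huw0 huw hu1 R R₁ hRd hRi
    hR₁d hR₁i
  -- 2. rescaled band on `[w, 1]` from `T = M`
  obtain ⟨S, hSd, hSi⟩ := exists_scaledRep (m := m) hG hd hu hw hc1 hu0 hw0 hw1 M hMd hMi huw0
    (fun _ _ => le_rfl) (fun x _ => by simp)
  have hSi' : EqOn S.integrand
      (fun z => d (Fin.init z) * ((u (Fin.init z) * z (Fin.last b) - 1) ^ m / z (Fin.last b)))
      S.domain := fun z _ => by rw [hSi]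
  have h3 : KZ.of S - KZ.of M ∈ KZ.relations :=
    of_scaled_sub_of_mem_relations hGo hG hu hud hu0 hw0 S M hSd hSi' hMd (fun _ _ => rfl)
      (fun x _ => by simp) hMi
  -- 3. fold to `−B`
  have h4 : KZ.of S - KZ.of R₂ - KZ.of B.neg ∈ KZ.relations := by
    refine polyBand_fold hd hu hw hc1 hw0 hw1 hu0 S R₂ B.neg hSd hSi' hR₂d hR₂i
      (by rw [← hBd]; rfl) fun x hx => ?_
    have hx' : x ∈ B.domain := hx
    show -B.integrand x = _
    rw [hBi hx']
    simp only [rho, mul_one, polyLog_one]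
    ring
  have h5 : KZ.of B + KZ.of B.neg ∈ KZ.relations :=
    KZ.of_add_of_mem_relations_of_eqOn_neg rfl fun _ _ => rfl
  have e : -KZ.of R - KZ.of R₁ + KZ.of R₂ - KZ.of B =
      (KZ.of M - KZ.of R - KZ.of R₁) + (KZ.of S - KZ.of M) - (KZ.of S - KZ.of R₂ - KZ.of B.neg) -
        (KZ.of B + KZ.of B.neg) := by abel
  rw [e]
  exact sub_mem (sub_mem (add_mem hM h3) h4) h5

/-- **`RegTorusProductNeg` — `0 < u ≤ 1`, `0 < w ≤ 1`, PROVED.**  All three cells reversed: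
`R = [{uw≤t≤1}]`, `R₁ = [{u≤t≤1}]`, `R₂ = [{w≤s≤1}]` (kernel `dk`):  `−[R] + [R₁] + [R₂] − [B] ∈ relations`. -/
theorem regTorusProductNeg {b m : ℕ} {G : Set (Fin b → ℝ)} {d u w : (Fin b → ℝ) → ℝ}
    (hGo : IsOpen G) (hG : IsSemialgebraic ℚ G) (hd : IsSemialgebraicFunOn ℚ G d)
    (hu : IsSemialgebraicFunOn ℚ G u) (hw : IsSemialgebraicFunOn ℚ G w)
    (hud : DifferentiableOn ℝ u G) (hu0 : ∀ x ∈ G, 0 < u x) (hu1 : ∀ x ∈ G, u x ≤ 1)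
    (hw0 : ∀ x ∈ G, 0 < w x) (hw1 : ∀ x ∈ G, w x ≤ 1)
    (R R₁ R₂ : KZ.IntegralRep (b + 1)) (B : KZ.IntegralRep b)
    (hRd : R.domain = KZlog.band G (fun x => u x * w x) (fun _ => 1))
    (hRi : EqOn R.integrand
      (fun z => d (Fin.init z) * ((z (Fin.last b) - 1) ^ m / z (Fin.last b))) R.domain)
    (hR₁d : R₁.domain = KZlog.band G u (fun _ => 1))
    (hR₁i : EqOn R₁.integrand
      (fun z => d (Fin.init z) * ((z (Fin.last b) - 1) ^ m / z (Fin.last b))) R₁.domain)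
    (hR₂d : R₂.domain = KZlog.band G w (fun _ => 1))
    (hR₂i : EqOn R₂.integrand
      (fun z => d (Fin.init z) * ((z (Fin.last b) - 1) ^ m / z (Fin.last b))) R₂.domain)
    (hBd : B.domain = G) (hBi : EqOn B.integrand (fun x => d x * rho m (u x) (w x)) B.domain) :
    -KZ.of R + KZ.of R₁ + KZ.of R₂ - KZ.of B ∈ KZ.relations := by
  have huwf : IsSemialgebraicFunOn ℚ G (fun x => u x * w x) := IsSemialgebraicFunOn.mul_holds hu hw
  have hc1 : IsSemialgebraicFunOn ℚ G (fun _ => (1 : ℝ)) := by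
    simpa using isSemialgebraicFunOn_ratCast hG 1
  have huw0 : ∀ x ∈ G, 0 < u x * w x := fun x hx => mul_pos (hu0 x hx) (hw0 x hx)
  have hle : ∀ x ∈ G, u x * w x ≤ u x := fun x hx =>
    mul_le_of_le_one_right (hu0 x hx).le (hw1 x hx)
  -- 1. split `R = [uw, 1]` at `t = u`: `M = [uw, u]`, `Ru = [u, 1] ~ R₁`
  have hbM : IsSemialgebraic ℚ (KZlog.band G (fun x => u x * w x) u) :=
    KZlog.isSemialgebraic_band huwf hu
  have hbu : IsSemialgebraic ℚ (KZlog.band G u fun _ => 1) := KZlog.isSemialgebraic_band hu hc1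
  have hsubM : KZlog.band G (fun x => u x * w x) u ⊆ R.domain := fun z hz =>
    hRd ▸ ⟨hz.1, hz.2.1, hz.2.2.trans (hu1 _ hz.1)⟩
  have hsubu : KZlog.band G u (fun _ => 1) ⊆ R.domain := fun z hz =>
    hRd ▸ ⟨hz.1, (hle _ hz.1).trans hz.2.1, hz.2.2⟩
  set M := R.restrict _ hbM hsubM with hM
  set Ru := R.restrict _ hbu hsubu with hRu
  have h1 : KZ.of R - KZ.of M - KZ.of Ru ∈ KZ.relations := by
    refine KZ.domainAddRel_subset_relations ⟨b + 1, R, M, Ru, ?_, ?_, fun _ _ => rfl,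
      fun _ _ => rfl, rfl⟩
    · rw [hRd, hM, hRu, KZ.IntegralRep.domain_restrict, KZ.IntegralRep.domain_restrict]
      ext z
      simp only [KZlog.band, mem_setOf_eq, mem_union]
      constructor
      · rintro ⟨hx, h1, h2⟩
        rcases le_total (z (Fin.last b)) (u (Fin.init z)) with h | h
        · exact Or.inl ⟨hx, h1, h⟩
        · exact Or.inr ⟨hx, h, h2⟩
      · rintro (⟨hx, h1, h2⟩ | ⟨hx, h1, h2⟩)
        · exact ⟨hx, h1, h2.trans (hu1 _ hx)⟩
        · exact ⟨hx, (hle _ hx).trans h1, h2⟩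
    · refine measure_mono_null (fun z hz => ?_) (KZ.volume_graph_eq_zero hu)
      rw [hM, hRu, KZ.IntegralRep.domain_restrict, KZ.IntegralRep.domain_restrict] at hz
      exact ⟨hz.1.1, le_antisymm hz.1.2.2 hz.2.2.1⟩
  have h2 : KZ.of Ru - KZ.of R₁ ∈ KZ.relations :=
    KZ.of_sub_of_mem_relations_of_eqOn (by rw [hR₁d, hRu, KZ.IntegralRep.domain_restrict])
      fun z hz => by
        rw [hRu, KZ.IntegralRep.domain_restrict] at hz
        rw [hRu, KZ.IntegralRep.integrand_restrict, hRi (hsubu hz), hR₁i (hR₁d ▸ hz)]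
  have hMd : M.domain = KZlog.band G (fun x => u x * w x) u := by
    rw [hM, KZ.IntegralRep.domain_restrict]
  have hMi : EqOn M.integrand
      (fun z => d (Fin.init z) * ((z (Fin.last b) - 1) ^ m / z (Fin.last b))) M.domain :=
    fun z hz => by
      rw [hM, KZ.IntegralRep.domain_restrict] at hz
      rw [hM, KZ.IntegralRep.integrand_restrict, hRi (hsubM hz)]
  -- 2. rescaled band on `[w, 1]` from `T = R`
  obtain ⟨S, hSd, hSi⟩ := exists_scaledRep (m := m) hG hd hu hw hc1 hu0 hw0 hw1 R hRd hRi huw0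
    (fun _ _ => le_rfl) (fun x hx => by simpa using hu1 x hx)
  have hSi' : EqOn S.integrand
      (fun z => d (Fin.init z) * ((u (Fin.init z) * z (Fin.last b) - 1) ^ m / z (Fin.last b)))
      S.domain := fun z _ => by rw [hSi]
  have h3 : KZ.of S - KZ.of M ∈ KZ.relations :=
    of_scaled_sub_of_mem_relations hGo hG hu hud hu0 hw0 S M hSd hSi' hMd (fun _ _ => rfl)
      (fun x _ => by simp) hMi
  -- 3. fold to `−B`
  have h4 : KZ.of S - KZ.of R₂ - KZ.of B.neg ∈ KZ.relations := by
    refine polyBand_fold hd hu hw hc1 hw0 hw1 hu0 S R₂ B.neg hSd hSi' hR₂d hR₂i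
      (by rw [← hBd]; rfl) fun x hx => ?_
    have hx' : x ∈ B.domain := hx
    show -B.integrand x = _
    rw [hBi hx']
    simp only [rho, mul_one, polyLog_one]
    ring
  have h5 : KZ.of B + KZ.of B.neg ∈ KZ.relations :=
    KZ.of_add_of_mem_relations_of_eqOn_neg rfl fun _ _ => rfl
  have e : -KZ.of R + KZ.of R₁ + KZ.of R₂ - KZ.of B =
      -(KZ.of R - KZ.of M - KZ.of Ru) - (KZ.of Ru - KZ.of R₁) + (KZ.of S - KZ.of M) -
        (KZ.of S - KZ.of R₂ - KZ.of B.neg) - (KZ.of B + KZ.of B.neg) := by abel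
  rw [e]
  exact sub_mem (sub_mem (add_mem (sub_mem (neg_mem h1) h2) h3) h4) h5

end CylLog
end RegularisedLogLayer
end Summit.KontsevichZagierPeriods.RootDecompRelativeModAbsolute.Rung30571
end
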